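import Summits.Ventures.Crystal3D.Theorems.StickyWulffConstantCoaxialWallLawTwinCageCore
import Summits.Ventures.Crystal3D.Theorems.StickyWulffConstantCoaxialWallLawOnSiteLocality
import Summits.Ventures.Crystal3D.Theorems.StickyWulffConstantGenericWallFloorEndBallMenuTable
import Summits.Ventures.Crystal3D.Theorems.StickyWulffConstantCoaxialWallLawSkewRoots
import HarnessLib

/-!
# The TWIN (hcp) CAGE: eleven of the twelve balls of a twin dozen force the twelfth contact
# (crux `CoaxialWallLaw`, stmt-Ventures-19481, line `WallLedgerF`; census-free brick for the NON-BARLOW tail)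

HONEST FRAMING. Venture `Summits/Ventures/Crystal3D` (cell `crystal3d-full`), helper `--supports` the crux
`CoaxialWallLaw` (stmt-Ventures-19481, `route-Ventures-StickyWulffConstant`), REGISTERED line `WallLedgerF` (planner
cf-p1, decision (lvi) «GO on the non-Barlow bricks»).  Rung credit; F-C1 not moved; census-free.  Companion of
`…CoaxialWallLawKissingCage` (fcc dozen) and `…CoaxialWallLawSaturatedReaders`; the arithmetic cells are in
`…CoaxialWallLawTwinCageCore`.

The TWIN DOZEN of a frame `G` and a menu normal `m` (vectors, no base point): the closed lower half-shell `G w`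
(`⟪G w, m⟫ ≤ 0`) together with the mirror images `G w − 2⟪G w, m⟫ m` of the open lower half-shell — the coordination
shell of a ball ON a composition plane.
* `inner_map_slotSite_menu` — `⟪G sₗ, m⟫ = (sₗ · c)/√6` for the sign vector `c` of `m` (`exists_cubeInt_of_menu_normal`);
* `twin_table_slot/_mirror/_cover` — `decide`d bookkeeping between slot labels, sign vectors and the scaled table;
* `twin_x_sq`, `twin_slot_ineq`, `twin_mirror_ineq`, `eq_slot_of_twin_coords`, `eq_mirror_of_twin_coords` — the
  passage to signed cubic coordinates `xᵢ = √2 · cᵢ · (cubic coordinate of G⁻¹ t)ᵢ` and back;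
* **`eq_of_twin_cage`** — for any frame `G`, menu normal `m`, member `d₀` of the twin dozen and unit `t`: `⟪t, d⟫ ≤ ½`
  for the other eleven members `d` forces `t = d₀`;
* **`contact_on_twinDozen_of_eleven`** — in a `1`-separated configuration, a host `y` carrying eleven of the twelve
  balls `y + d` of a twin dozen is touched only on that dozen (the twelfth position included).
WHAT THIS IS NOT: not the tail; F-C1 not moved.
-/

noncomputable section

namespace Summit.Ventures.Crystal3D.Theorems

open Summit.Ventures.Crystal3D Finset NearIdentity
open scoped InnerProductSpace

/-! ### Tables -/

/-- Lower-half slots land in the scaled table. -/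
theorem twin_table_slot : ∀ c : Fin 8, ∀ l : Fin 12, sdot3 (slotInt l) (cubeInt c) ≤ 0 →
    (3 * (slotInt l 0 * cubeInt c 0), 3 * (slotInt l 1 * cubeInt c 1), 3 * (slotInt l 2 * cubeInt c 2)) ∈
      ({(3, -3, 0), (-3, 3, 0), (-3, -3, 0), (3, 0, -3), (-3, 0, 3), (-3, 0, -3), (0, 3, -3), (0, -3, 3), (0, -3, -3),
        (1, 1, 4), (1, 4, 1), (4, 1, 1)} : Finset (ℤ × ℤ × ℤ)) := by
  decide

/-- Mirrors of the open lower half land in the scaled table. -/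
theorem twin_table_mirror : ∀ c : Fin 8, ∀ l : Fin 12, sdot3 (slotInt l) (cubeInt c) = -2 →
    (3 * (slotInt l 0 * cubeInt c 0) + 4, 3 * (slotInt l 1 * cubeInt c 1) + 4, 3 * (slotInt l 2 * cubeInt c 2) + 4) ∈
      ({(3, -3, 0), (-3, 3, 0), (-3, -3, 0), (3, 0, -3), (-3, 0, 3), (-3, 0, -3), (0, 3, -3), (0, -3, 3), (0, -3, -3),
        (1, 1, 4), (1, 4, 1), (4, 1, 1)} : Finset (ℤ × ℤ × ℤ)) := by
  decide

/-- Every table entry is a lower-half slot or a mirror, for every sign vector. -/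
theorem twin_table_cover : ∀ c : Fin 8,
    ∀ τ ∈ ({(3, -3, 0), (-3, 3, 0), (-3, -3, 0), (3, 0, -3), (-3, 0, 3), (-3, 0, -3), (0, 3, -3), (0, -3, 3), (0, -3, -3),
        (1, 1, 4), (1, 4, 1), (4, 1, 1)} : Finset (ℤ × ℤ × ℤ)),
      (∃ l : Fin 12, sdot3 (slotInt l) (cubeInt c) ≤ 0 ∧
        τ = (3 * (slotInt l 0 * cubeInt c 0), 3 * (slotInt l 1 * cubeInt c 1), 3 * (slotInt l 2 * cubeInt c 2))) ∨
      (∃ l : Fin 12, sdot3 (slotInt l) (cubeInt c) = -2 ∧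
        τ = (3 * (slotInt l 0 * cubeInt c 0) + 4, 3 * (slotInt l 1 * cubeInt c 1) + 4,
          3 * (slotInt l 2 * cubeInt c 2) + 4)) := by
  decide

/-- The sign of a slot against a menu normal is `0` or `±2` in the table; negative means `−2`. -/
theorem sdot3_eq_neg_two_of_neg (c : Fin 8) (l : Fin 12) (h : sdot3 (slotInt l) (cubeInt c) < 0) :
    sdot3 (slotInt l) (cubeInt c) = -2 := by
  rcases sdot3_slotInt_cubeInt l c with h' | h' | h' <;> omega

/-! ### Signed cubic coordinates -/

/-- `⟪G sₗ, m⟫ = (sₗ · c)/√6` when `G⁻¹ m` has cubic coordinates `c/√3`. -/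
theorem inner_map_slotSite_menu {G : EuclideanSpace ℝ (Fin 3) ≃ₗᵢ[ℝ] EuclideanSpace ℝ (Fin 3)}
    {m : EuclideanSpace ℝ (Fin 3)} {c : Fin 8}
    (hc : cubicCoords (G.symm m) = fun j => (cubeInt c j : ℝ) / Real.sqrt 3) (l : Fin 12) :
    ⟪G (slotSite l), m⟫_ℝ = (sdot3 (slotInt l) (cubeInt c) : ℝ) / Real.sqrt 6 := by
  have h1 : ⟪G (slotSite l), m⟫_ℝ = ⟪slotSite l, G.symm m⟫_ℝ := by
    rw [← G.inner_map_map (slotSite l) (G.symm m), G.apply_symm_apply]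
  rw [h1, inner_eq_cubicCoords, cubicCoords_slotSite, hc]
  have h6 : Real.sqrt 6 = Real.sqrt 2 * Real.sqrt 3 := by
    rw [← Real.sqrt_mul (by norm_num : (0 : ℝ) ≤ 2) 3]; norm_num
  have h2 : Real.sqrt 2 ≠ 0 := by positivity
  have h3 : Real.sqrt 3 ≠ 0 := by positivity
  simp only [dotProduct, Fin.sum_univ_three, slotVec, sdot3, h6]
  push_cast
  field_simp

/-- The signed cubic coordinates of a unit vector have `Σ xᵢ² = 2`. -/
theorem twin_x_sq (c : Fin 8) {s : EuclideanSpace ℝ (Fin 3)} (hs : ‖s‖ = 1) :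
    (Real.sqrt 2 * cubeInt c 0 * cubicCoords s 0) ^ 2 + (Real.sqrt 2 * cubeInt c 1 * cubicCoords s 1) ^ 2 +
      (Real.sqrt 2 * cubeInt c 2 * cubicCoords s 2) ^ 2 = 2 := by
  have hsq := norm_sq_eq_cubicCoords_sum s
  rw [hs, one_pow] at hsq
  have hc2 : ∀ i, ((cubeInt c i : ℤ) : ℝ) ^ 2 = 1 := fun i => by
    rcases cubeInt_pm_one c i with h | h <;> simp [h]
  have h2 : Real.sqrt 2 ^ 2 = 2 := Real.sq_sqrt (by norm_num)
  simp only [mul_pow, hc2, h2]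
  linarith

/-- A slot constraint `⟪t, G sₗ⟫ ≤ ½` in signed cubic coordinates: `x · (3 sₗ c) ≤ 3`. -/
theorem twin_slot_ineq (G : EuclideanSpace ℝ (Fin 3) ≃ₗᵢ[ℝ] EuclideanSpace ℝ (Fin 3)) (c : Fin 8)
    {t : EuclideanSpace ℝ (Fin 3)} (l : Fin 12) (h : ⟪t, G (slotSite l)⟫_ℝ ≤ 1 / 2) :
    Real.sqrt 2 * cubeInt c 0 * cubicCoords (G.symm t) 0 * ((3 * (slotInt l 0 * cubeInt c 0) : ℤ) : ℝ) +
      Real.sqrt 2 * cubeInt c 1 * cubicCoords (G.symm t) 1 * ((3 * (slotInt l 1 * cubeInt c 1) : ℤ) : ℝ) +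
      Real.sqrt 2 * cubeInt c 2 * cubicCoords (G.symm t) 2 * ((3 * (slotInt l 2 * cubeInt c 2) : ℤ) : ℝ) ≤ 3 := by
  have e : ⟪t, G (slotSite l)⟫_ℝ = ⟪G.symm t, slotSite l⟫_ℝ := by
    rw [← G.inner_map_map (G.symm t) (slotSite l), G.apply_symm_apply]
  have h2p : 0 < Real.sqrt 2 := Real.sqrt_pos.2 (by norm_num)
  have h22 : Real.sqrt 2 ^ 2 = 2 := Real.sq_sqrt (by norm_num)
  rw [e, inner_slotSite_right, div_le_iff₀ h2p] at h
  have hc2 : ∀ i, ((cubeInt c i : ℤ) : ℝ) * (cubeInt c i : ℤ) = 1 := fun i => by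
    rcases cubeInt_pm_one c i with h | h <;> simp [h]
  have key : ∀ i, Real.sqrt 2 * cubeInt c i * cubicCoords (G.symm t) i * ((3 * (slotInt l i * cubeInt c i) : ℤ) : ℝ) =
      3 * Real.sqrt 2 * (cubicCoords (G.symm t) i * slotInt l i) := by
    intro i; push_cast
    linear_combination (3 * Real.sqrt 2 * cubicCoords (G.symm t) i * slotInt l i) * hc2 i
  rw [key 0, key 1, key 2]
  nlinarith [h, h22, h2p]

/-- A mirror constraint `⟪t, G sₗ − 2⟪G sₗ, m⟫ m⟫ ≤ ½` (`sₗ · c = −2`) in signed cubic coordinates: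
`x · (3 sₗ c + 4) ≤ 3`. -/
theorem twin_mirror_ineq {G : EuclideanSpace ℝ (Fin 3) ≃ₗᵢ[ℝ] EuclideanSpace ℝ (Fin 3)}
    {m : EuclideanSpace ℝ (Fin 3)} {c : Fin 8}
    (hc : cubicCoords (G.symm m) = fun j => (cubeInt c j : ℝ) / Real.sqrt 3)
    {t : EuclideanSpace ℝ (Fin 3)} (l : Fin 12) (hsum : sdot3 (slotInt l) (cubeInt c) = -2)
    (h : ⟪t, G (slotSite l) - (2 * ⟪G (slotSite l), m⟫_ℝ) • m⟫_ℝ ≤ 1 / 2) :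
    Real.sqrt 2 * cubeInt c 0 * cubicCoords (G.symm t) 0 * ((3 * (slotInt l 0 * cubeInt c 0) + 4 : ℤ) : ℝ) +
      Real.sqrt 2 * cubeInt c 1 * cubicCoords (G.symm t) 1 * ((3 * (slotInt l 1 * cubeInt c 1) + 4 : ℤ) : ℝ) +
      Real.sqrt 2 * cubeInt c 2 * cubicCoords (G.symm t) 2 * ((3 * (slotInt l 2 * cubeInt c 2) + 4 : ℤ) : ℝ) ≤ 3 := by
  have e1 : ⟪t, G (slotSite l)⟫_ℝ = ⟪G.symm t, slotSite l⟫_ℝ := by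
    rw [← G.inner_map_map (G.symm t) (slotSite l), G.apply_symm_apply]
  have e2 : ⟪t, m⟫_ℝ = ⟪G.symm t, G.symm m⟫_ℝ := by rw [G.symm.inner_map_map]
  have h2p : 0 < Real.sqrt 2 := Real.sqrt_pos.2 (by norm_num)
  have h3p : 0 < Real.sqrt 3 := Real.sqrt_pos.2 (by norm_num)
  have h22 : Real.sqrt 2 ^ 2 = 2 := Real.sq_sqrt (by norm_num)
  have h33 : Real.sqrt 3 ^ 2 = 3 := Real.sq_sqrt (by norm_num)
  have h6 : Real.sqrt 6 = Real.sqrt 2 * Real.sqrt 3 := by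
    rw [← Real.sqrt_mul (by norm_num : (0 : ℝ) ≤ 2) 3]; norm_num
  rw [inner_sub_right, inner_smul_right, inner_map_slotSite_menu hc l, hsum, e1, inner_slotSite_right, e2,
    inner_eq_cubicCoords (G.symm t) (G.symm m), hc] at h
  simp only [dotProduct, Fin.sum_univ_three, h6] at h
  push_cast at h
  have hc2 : ∀ i, ((cubeInt c i : ℤ) : ℝ) * (cubeInt c i : ℤ) = 1 := fun i => by
    rcases cubeInt_pm_one c i with h | h <;> simp [h]
  have key : ∀ i, Real.sqrt 2 * cubeInt c i * cubicCoords (G.symm t) i * ((3 * (slotInt l i * cubeInt c i) + 4 : ℤ) : ℝ)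
      = 3 * Real.sqrt 2 * (cubicCoords (G.symm t) i * slotInt l i) +
        4 * Real.sqrt 2 * (cubicCoords (G.symm t) i * cubeInt c i) := by
    intro i; push_cast
    linear_combination (3 * Real.sqrt 2 * cubicCoords (G.symm t) i * slotInt l i) * hc2 i
  rw [key 0, key 1, key 2]
  set A := cubicCoords (G.symm t) 0 * slotInt l 0 + cubicCoords (G.symm t) 1 * slotInt l 1 +
    cubicCoords (G.symm t) 2 * slotInt l 2 with hA
  set B := cubicCoords (G.symm t) 0 * cubeInt c 0 + cubicCoords (G.symm t) 1 * cubeInt c 1 +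
    cubicCoords (G.symm t) 2 * cubeInt c 2 with hB
  have h' : A / Real.sqrt 2 - 2 * ((-2 : ℝ) / (Real.sqrt 2 * Real.sqrt 3)) * (B / Real.sqrt 3) ≤ 1 / 2 := by
    have : A / Real.sqrt 2 - 2 * ((-2 : ℝ) / (Real.sqrt 2 * Real.sqrt 3)) * (B / Real.sqrt 3) =
        A / Real.sqrt 2 - 2 * ((-2 : ℝ) / (Real.sqrt 2 * Real.sqrt 3)) *
          (cubicCoords (G.symm t) 0 * (cubeInt c 0 / Real.sqrt 3) + cubicCoords (G.symm t) 1 * (cubeInt c 1 / Real.sqrt 3) +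
            cubicCoords (G.symm t) 2 * (cubeInt c 2 / Real.sqrt 3)) := by
      rw [hB]; ring
    rw [this]; exact h
  have h'' : 3 * A + 4 * B ≤ 3 * Real.sqrt 2 / 2 := by
    have hden : A / Real.sqrt 2 - 2 * ((-2 : ℝ) / (Real.sqrt 2 * Real.sqrt 3)) * (B / Real.sqrt 3) =
        (3 * A + 4 * B) / (3 * Real.sqrt 2) := by
      field_simp
      rw [h33]; ring
    rw [hden, div_le_iff₀ (by positivity)] at h'
    nlinarith [h']
  nlinarith [h'', h22]

/-- Back from coordinates, slot target: `3x = 3 s₀ c` forces `t = G s₀`. -/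
theorem eq_slot_of_twin_coords (G : EuclideanSpace ℝ (Fin 3) ≃ₗᵢ[ℝ] EuclideanSpace ℝ (Fin 3)) (c : Fin 8)
    {t : EuclideanSpace ℝ (Fin 3)} (l₀ : Fin 12)
    (e : ∀ i, 3 * (Real.sqrt 2 * cubeInt c i * cubicCoords (G.symm t) i) = ((3 * (slotInt l₀ i * cubeInt c i) : ℤ) : ℝ)) :
    t = G (slotSite l₀) := by
  have h2p : 0 < Real.sqrt 2 := Real.sqrt_pos.2 (by norm_num)
  have hc2 : ∀ i, ((cubeInt c i : ℤ) : ℝ) * (cubeInt c i : ℤ) = 1 := fun i => by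
    rcases cubeInt_pm_one c i with h | h <;> simp [h]
  have hcc : cubicCoords (G.symm t) = cubicCoords (slotSite l₀) := by
    rw [cubicCoords_slotSite]
    ext i
    simp only [slotVec]
    rw [eq_div_iff h2p.ne']
    have := e i
    push_cast at this
    linear_combination (cubeInt c i : ℝ) / 3 * this - (Real.sqrt 2 * cubicCoords (G.symm t) i - slotInt l₀ i) * hc2 i
  have := cubicCoords_injective hcc
  rw [← this, G.apply_symm_apply]

/-- Back from coordinates, mirror target: `3x = 3 s₀ c + 4` forces `t = G s₀ − 2⟪G s₀, m⟫ m`. -/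
theorem eq_mirror_of_twin_coords {G : EuclideanSpace ℝ (Fin 3) ≃ₗᵢ[ℝ] EuclideanSpace ℝ (Fin 3)}
    {m : EuclideanSpace ℝ (Fin 3)} {c : Fin 8}
    (hc : cubicCoords (G.symm m) = fun j => (cubeInt c j : ℝ) / Real.sqrt 3)
    {t : EuclideanSpace ℝ (Fin 3)} (l₀ : Fin 12) (hsum : sdot3 (slotInt l₀) (cubeInt c) = -2)
    (e : ∀ i, 3 * (Real.sqrt 2 * cubeInt c i * cubicCoords (G.symm t) i) =
      ((3 * (slotInt l₀ i * cubeInt c i) + 4 : ℤ) : ℝ)) :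
    t = G (slotSite l₀) - (2 * ⟪G (slotSite l₀), m⟫_ℝ) • m := by
  have h2p : 0 < Real.sqrt 2 := Real.sqrt_pos.2 (by norm_num)
  have h3p : 0 < Real.sqrt 3 := Real.sqrt_pos.2 (by norm_num)
  have h33 : Real.sqrt 3 ^ 2 = 3 := Real.sq_sqrt (by norm_num)
  have h6 : Real.sqrt 6 = Real.sqrt 2 * Real.sqrt 3 := by
    rw [← Real.sqrt_mul (by norm_num : (0 : ℝ) ≤ 2) 3]; norm_num
  have hc2 : ∀ i, ((cubeInt c i : ℤ) : ℝ) * (cubeInt c i : ℤ) = 1 := fun i => by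
    rcases cubeInt_pm_one c i with h | h <;> simp [h]
  have hsymm : G.symm (G (slotSite l₀) - (2 * ⟪G (slotSite l₀), m⟫_ℝ) • m) =
      slotSite l₀ - (2 * ⟪G (slotSite l₀), m⟫_ℝ) • G.symm m := by
    rw [map_sub, LinearIsometryEquiv.map_smul, G.symm_apply_apply]
  have hcc : cubicCoords (G.symm t) = cubicCoords (G.symm (G (slotSite l₀) - (2 * ⟪G (slotSite l₀), m⟫_ℝ) • m)) := by
    rw [hsymm, cubicCoords_sub, cubicCoords_smul, cubicCoords_slotSite, hc, inner_map_slotSite_menu hc l₀, hsum, h6]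
    ext i
    simp only [slotVec, Pi.sub_apply, Pi.smul_apply, smul_eq_mul]
    have := e i
    push_cast at this ⊢
    have h1 : 3 * Real.sqrt 2 * cubicCoords (G.symm t) i = 3 * slotInt l₀ i + 4 * cubeInt c i := by
      linear_combination (cubeInt c i : ℝ) * this -
        (3 * Real.sqrt 2 * cubicCoords (G.symm t) i - 3 * slotInt l₀ i) * hc2 i
    have h1' : cubicCoords (G.symm t) i = (3 * slotInt l₀ i + 4 * cubeInt c i) / (3 * Real.sqrt 2) := by
      rw [eq_div_iff (by positivity)]; linarith
    rw [h1']
    field_simp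
    rw [h33]; ring
  have := cubicCoords_injective hcc
  have := congrArg G this
  simpa using this

/-! ### The twin cage -/

/-- Membership in the twin dozen, unfolded. -/
theorem mem_twinDozenVec_iff (G : EuclideanSpace ℝ (Fin 3) ≃ₗᵢ[ℝ] EuclideanSpace ℝ (Fin 3))
    (m d : EuclideanSpace ℝ (Fin 3)) :
    d ∈ ((fccSlots.filter fun w => ⟪G w, m⟫_ℝ ≤ 0).image fun w => G w) ∪
        ((fccSlots.filter fun w => ⟪G w, m⟫_ℝ < 0).image fun w => G w - (2 * ⟪G w, m⟫_ℝ) • m) ↔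
      (∃ w ∈ fccSlots, ⟪G w, m⟫_ℝ ≤ 0 ∧ d = G w) ∨
        ∃ w ∈ fccSlots, ⟪G w, m⟫_ℝ < 0 ∧ d = G w - (2 * ⟪G w, m⟫_ℝ) • m := by
  classical
  simp only [Finset.mem_union, Finset.mem_image, Finset.mem_filter, and_assoc, eq_comm (a := d)]

/-- The mirror image reads `−⟪G w, m⟫` against the unit normal `m`. -/
theorem inner_mirror_menu (G : EuclideanSpace ℝ (Fin 3) ≃ₗᵢ[ℝ] EuclideanSpace ℝ (Fin 3))
    {m : EuclideanSpace ℝ (Fin 3)} (hm : ‖m‖ = 1) (w : EuclideanSpace ℝ (Fin 3)) :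
    ⟪G w - (2 * ⟪G w, m⟫_ℝ) • m, m⟫_ℝ = -⟪G w, m⟫_ℝ := by
  rw [inner_sub_left, inner_smul_left, real_inner_self_eq_norm_sq, hm]; simp; ring

/-- **THE TWIN CAGE.**  For any frame `G`, menu normal `m`, member `d₀` of the twin dozen of `(G, m)` and unit vector
`t`: if `⟪t, d⟫ ≤ ½` for every other member `d` of the dozen, then `t = d₀`. -/
theorem eq_of_twin_cage (G : EuclideanSpace ℝ (Fin 3) ≃ₗᵢ[ℝ] EuclideanSpace ℝ (Fin 3)) {m : EuclideanSpace ℝ (Fin 3)}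
    (hm : IsMenuNormal G m) {t : EuclideanSpace ℝ (Fin 3)} (ht : ‖t‖ = 1) {d₀ : EuclideanSpace ℝ (Fin 3)}
    (hd₀ : d₀ ∈ ((fccSlots.filter fun w => ⟪G w, m⟫_ℝ ≤ 0).image fun w => G w) ∪
        ((fccSlots.filter fun w => ⟪G w, m⟫_ℝ < 0).image fun w => G w - (2 * ⟪G w, m⟫_ℝ) • m))
    (h : ∀ d ∈ ((fccSlots.filter fun w => ⟪G w, m⟫_ℝ ≤ 0).image fun w => G w) ∪
        ((fccSlots.filter fun w => ⟪G w, m⟫_ℝ < 0).image fun w => G w - (2 * ⟪G w, m⟫_ℝ) • m),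
      d ≠ d₀ → ⟪t, d⟫_ℝ ≤ 1 / 2) :
    t = d₀ := by
  classical
  obtain ⟨c, hc⟩ := exists_cubeInt_of_menu_normal G hm.1 hm.2
  have hs1 : ‖G.symm t‖ = 1 := by rw [LinearIsometryEquiv.norm_map, ht]
  have hn := twin_x_sq c hs1
  have h6p : 0 < Real.sqrt 6 := Real.sqrt_pos.2 (by norm_num)
  -- sign bookkeeping: `⟪G sₗ, m⟫ ≤ 0 ↔ sₗ·c ≤ 0`, `< 0 ↔ sₗ·c = -2`
  have sgn_le : ∀ l, ⟪G (slotSite l), m⟫_ℝ ≤ 0 ↔ sdot3 (slotInt l) (cubeInt c) ≤ 0 := by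
    intro l; rw [inner_map_slotSite_menu hc l, div_nonpos_iff]
    constructor
    · rintro (⟨_, h0⟩ | ⟨h0, _⟩)
      · exact absurd h0 (not_le.2 h6p)
      · exact_mod_cast h0
    · intro h0; exact Or.inr ⟨by exact_mod_cast h0, h6p.le⟩
  have sgn_lt : ∀ l, ⟪G (slotSite l), m⟫_ℝ < 0 ↔ sdot3 (slotInt l) (cubeInt c) = -2 := by
    intro l; rw [inner_map_slotSite_menu hc l, div_neg_iff]
    constructor
    · rintro (⟨_, h0⟩ | ⟨h0, _⟩)
      · exact absurd h0 (not_lt.2 h6p.le)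
      · exact sdot3_eq_neg_two_of_neg c l (by exact_mod_cast h0)
    · intro h0; exact Or.inr ⟨by rw [h0]; norm_num, h6p⟩
  -- members of the dozen attached to table entries
  have memS : ∀ l, sdot3 (slotInt l) (cubeInt c) ≤ 0 →
      G (slotSite l) ∈ ((fccSlots.filter fun w => ⟪G w, m⟫_ℝ ≤ 0).image fun w => G w) ∪
        ((fccSlots.filter fun w => ⟪G w, m⟫_ℝ < 0).image fun w => G w - (2 * ⟪G w, m⟫_ℝ) • m) := fun l hl =>
    (mem_twinDozenVec_iff G m _).2 (Or.inl ⟨slotSite l, slotSite_mem l, (sgn_le l).2 hl, rfl⟩)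
  have memM : ∀ l, sdot3 (slotInt l) (cubeInt c) = -2 →
      G (slotSite l) - (2 * ⟪G (slotSite l), m⟫_ℝ) • m ∈
        ((fccSlots.filter fun w => ⟪G w, m⟫_ℝ ≤ 0).image fun w => G w) ∪
        ((fccSlots.filter fun w => ⟪G w, m⟫_ℝ < 0).image fun w => G w - (2 * ⟪G w, m⟫_ℝ) • m) := fun l hl =>
    (mem_twinDozenVec_iff G m _).2 (Or.inr ⟨slotSite l, slotSite_mem l, (sgn_lt l).2 hl, rfl⟩)
  set x : Fin 3 → ℝ := fun i => Real.sqrt 2 * cubeInt c i * cubicCoords (G.symm t) i with hx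
  rcases (mem_twinDozenVec_iff G m d₀).1 hd₀ with ⟨w₀, hw₀, hle₀, rfl⟩ | ⟨w₀, hw₀, hlt₀, rfl⟩
  · -- slot target
    obtain ⟨l₀, rfl⟩ := exists_slotSite_eq hw₀
    have hsum₀ := (sgn_le l₀).1 hle₀
    have H : ∀ τ ∈ ({(3, -3, 0), (-3, 3, 0), (-3, -3, 0), (3, 0, -3), (-3, 0, 3), (-3, 0, -3), (0, 3, -3), (0, -3, 3),
        (0, -3, -3), (1, 1, 4), (1, 4, 1), (4, 1, 1)} : Finset (ℤ × ℤ × ℤ)),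
        τ ≠ (3 * (slotInt l₀ 0 * cubeInt c 0), 3 * (slotInt l₀ 1 * cubeInt c 1), 3 * (slotInt l₀ 2 * cubeInt c 2)) →
        x 0 * τ.1 + x 1 * τ.2.1 + x 2 * τ.2.2 ≤ 3 := by
      intro τ hτ hne
      rcases twin_table_cover c τ hτ with ⟨l, hl, rfl⟩ | ⟨l, hl, rfl⟩
      · refine twin_slot_ineq G c l (h _ (memS l hl) fun heq => hne ?_)
        rw [slotSite_injective (G.injective heq)]
      · refine twin_mirror_ineq hc l hl (h _ (memM l hl) fun heq => ?_)
        have h1 := inner_mirror_menu G hm.1 (slotSite l)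
        rw [heq] at h1
        have h2 := (sgn_lt l).2 hl
        linarith
    obtain ⟨e0, e1, e2⟩ := twin_core_triple x hn _ _ _ (twin_table_slot c l₀ hsum₀) H
    refine eq_slot_of_twin_coords G c l₀ fun i => ?_
    fin_cases i
    · exact e0
    · exact e1
    · exact e2
  · -- mirror target
    obtain ⟨l₀, rfl⟩ := exists_slotSite_eq hw₀
    have hsum₀ := (sgn_lt l₀).1 hlt₀
    have H : ∀ τ ∈ ({(3, -3, 0), (-3, 3, 0), (-3, -3, 0), (3, 0, -3), (-3, 0, 3), (-3, 0, -3), (0, 3, -3), (0, -3, 3),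
        (0, -3, -3), (1, 1, 4), (1, 4, 1), (4, 1, 1)} : Finset (ℤ × ℤ × ℤ)),
        τ ≠ (3 * (slotInt l₀ 0 * cubeInt c 0) + 4, 3 * (slotInt l₀ 1 * cubeInt c 1) + 4,
          3 * (slotInt l₀ 2 * cubeInt c 2) + 4) →
        x 0 * τ.1 + x 1 * τ.2.1 + x 2 * τ.2.2 ≤ 3 := by
      intro τ hτ hne
      rcases twin_table_cover c τ hτ with ⟨l, hl, rfl⟩ | ⟨l, hl, rfl⟩
      · refine twin_slot_ineq G c l (h _ (memS l hl) fun heq => ?_)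
        have h1 := inner_mirror_menu G hm.1 (slotSite l₀)
        rw [← heq] at h1
        have h2 := (sgn_le l).2 hl
        linarith
      · refine twin_mirror_ineq hc l hl (h _ (memM l hl) fun heq => hne ?_)
        have h1 := congrArg (fun u => ⟪u, m⟫_ℝ) heq
        simp only [inner_mirror_menu G hm.1] at h1
        have h2 : G (slotSite l) = G (slotSite l₀) := by
          have : (2 * ⟪G (slotSite l), m⟫_ℝ) • m = (2 * ⟪G (slotSite l₀), m⟫_ℝ) • m := by rw [neg_inj.1 h1]
          rw [this] at heq
          exact sub_left_injective heq
        rw [slotSite_injective (G.injective h2)]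
    obtain ⟨e0, e1, e2⟩ := twin_core_triple x hn _ _ _ (twin_table_mirror c l₀ hsum₀) H
    refine eq_mirror_of_twin_coords hc l₀ hsum₀ fun i => ?_
    fin_cases i
    · exact e0
    · exact e1
    · exact e2

/-- **Foreign contacts at a twin host need a second vacancy.**  In a `1`-separated configuration `X`, if the host `y`
carries the eleven balls `y + d` of a twin dozen other than `y + d₀`, then every ball of `X` touching `y` is `y + d`
for SOME member `d` of the dozen (the twelfth, `d₀`, included). -/
theorem contact_on_twinDozen_of_eleven {X : Finset (EuclideanSpace ℝ (Fin 3))}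
    (hX : ∀ p ∈ X, ∀ q ∈ X, p ≠ q → 1 ≤ dist p q)
    (G : EuclideanSpace ℝ (Fin 3) ≃ₗᵢ[ℝ] EuclideanSpace ℝ (Fin 3)) {m : EuclideanSpace ℝ (Fin 3)}
    (hm : IsMenuNormal G m) {y d₀ : EuclideanSpace ℝ (Fin 3)}
    (hd₀ : d₀ ∈ ((fccSlots.filter fun w => ⟪G w, m⟫_ℝ ≤ 0).image fun w => G w) ∪
        ((fccSlots.filter fun w => ⟪G w, m⟫_ℝ < 0).image fun w => G w - (2 * ⟪G w, m⟫_ℝ) • m))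
    (hfull : ∀ d ∈ ((fccSlots.filter fun w => ⟪G w, m⟫_ℝ ≤ 0).image fun w => G w) ∪
        ((fccSlots.filter fun w => ⟪G w, m⟫_ℝ < 0).image fun w => G w - (2 * ⟪G w, m⟫_ℝ) • m),
      d ≠ d₀ → y + d ∈ X)
    {x : EuclideanSpace ℝ (Fin 3)} (hx : x ∈ X) (hd : dist x y = 1) :
    ∃ d ∈ ((fccSlots.filter fun w => ⟪G w, m⟫_ℝ ≤ 0).image fun w => G w) ∪
        ((fccSlots.filter fun w => ⟪G w, m⟫_ℝ < 0).image fun w => G w - (2 * ⟪G w, m⟫_ℝ) • m),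
      x = y + d := by
  classical
  by_cases hon : ∃ d ∈ ((fccSlots.filter fun w => ⟪G w, m⟫_ℝ ≤ 0).image fun w => G w) ∪
      ((fccSlots.filter fun w => ⟪G w, m⟫_ℝ < 0).image fun w => G w - (2 * ⟪G w, m⟫_ℝ) • m), x = y + d
  · exact hon
  push Not at hon
  refine ⟨d₀, hd₀, ?_⟩
  have ht : ‖x - y‖ = 1 := by rwa [← dist_eq_norm]
  have hnorm : ∀ d ∈ ((fccSlots.filter fun w => ⟪G w, m⟫_ℝ ≤ 0).image fun w => G w) ∪
      ((fccSlots.filter fun w => ⟪G w, m⟫_ℝ < 0).image fun w => G w - (2 * ⟪G w, m⟫_ℝ) • m), ‖d‖ = 1 := by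
    intro d hd'
    rcases (mem_twinDozenVec_iff G m d).1 hd' with ⟨w, hw, -, rfl⟩ | ⟨w, hw, -, rfl⟩
    · rw [LinearIsometryEquiv.norm_map, norm_eq_one_of_mem_fccSlots hw]
    · exact norm_reflectStep_slot G hm.1 hw
  have key : x - y = d₀ := by
    refine eq_of_twin_cage G hm ht hd₀ fun d hd' hne => ?_
    refine inner_le_half_of_norm_sub_ge_one ht (hnorm d hd') ?_
    have := hX x hx (y + d) (hfull d hd' hne) (hon d hd')
    rwa [dist_eq_norm, show x - (y + d) = x - y - d by abel] at this
  rw [← key]; abel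

end Summit.Ventures.Crystal3D.Theorems

end
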